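import Summits.AnomalousDissipation.AnomalousDissipation.Theorems.GenericRunawayStokesScaling.Negative.Helicity

/-!
# Crux `MirrorVariety.GenericRunawayStokesScaling` (stmt-AnomalousDissipation-2990), line `idea-sketch-ideator3`:
# the EULER SHADOW step `stub_stokesRateOfEulerProper`

On the steady Galerkin variety `V_S(g)` (`S = PB N`), the equation `galerkinRHS S ν g c = 0` reads
`F₀(c) = ν A c`, where `F₀(c) := galerkinRHS S 0 g c = Π(ĝ - B(c,c))` is the truncated Euler map and
`(A c)_k = 4π²|k|² c_k` (`galerkinRHS_eq_neg_smul_stokesA_add`).  In sup norm `‖A c‖ ≤ C_S ‖c‖` with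
`C_S = 4π² ∑_{m∈S} |m|²` (`norm_stokesA_le`), so properness of `F₀` with margin `δ` beyond radius `M`
gives `δ ≤ |ν| C_S ‖c‖` at every zero with `‖c‖ ≥ M`, whence the Stokes rate
`ν²‖c‖² ≥ (δ/(C_S+1))² > 0` (`stub_stokesRateOfEulerProper`).  Supports stmt-AnomalousDissipation-2990.
-/

set_option linter.dupNamespace false

noncomputable section

open scoped BigOperators InnerProductSpace ComplexConjugate Topology
open Filter Set Function

namespace Summit.AnomalousDissipation.AnomalousDissipation.Theorems.GenericRunawayStokesScaling.Line

open Literature.Analysis.FunctionSpaces Literature.Analysis.FunctionSpaces.Torus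
open Literature.Analysis.FluidPDE Literature.Analysis.FluidPDE.Torus
open Summit.AnomalousDissipation.AnomalousDissipation.Theses.MirrorVariety
open Summit.AnomalousDissipation.AnomalousDissipation.Theorems.GenericRunawayStokesScaling.Negative

/-- The Galerkin field splits off its Stokes part: `F(c, ν) = -ν A c + F(c, 0)`, with `F(c, 0) = Π(ĝ - B(c,c))`
the truncated Euler map. [folklore] -/
theorem galerkinRHS_eq_neg_smul_stokesA_add {S : Finset (Fin 3 → ℤ)} (ν : ℝ)
    (g c : ↥S → EuclideanSpace ℂ (Fin 3)) :
    galerkinRHS S ν g c = -(ν • stokesA S c) + galerkinRHS S 0 g c := by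
  have h1 : galerkinRHS S ν g c = Fmap S g (c, ν) := rfl
  have h0 : galerkinRHS S 0 g c = Fmap S g (c, 0) := rfl
  rw [h1, h0, Fmap_apply, Fmap_apply]
  simp only [zero_smul, neg_zero, zero_add]
  abel

/-- The Stokes operator is bounded in sup norm: `‖A c‖ ≤ 4π² (∑_{m∈S} |m|²) ‖c‖`. [folklore] -/
theorem norm_stokesA_le {S : Finset (Fin 3 → ℤ)} (c : ↥S → EuclideanSpace ℂ (Fin 3)) :
    ‖stokesA S c‖ ≤ (4 * Real.pi ^ 2 * ∑ m ∈ S, freqNormSq m) * ‖c‖ := by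
  have h0 : 0 ≤ 4 * Real.pi ^ 2 * ∑ m ∈ S, freqNormSq m := by
    have := Finset.sum_nonneg fun m (_ : m ∈ S) => freqNormSq_nonneg m; positivity
  exact (pi_norm_le_iff_of_nonneg (mul_nonneg h0 (norm_nonneg _))).2 fun k => norm_stokesA_apply_le c k

/-- On the variety the truncated Euler map equals the Stokes term: `F(c, 0) = ν A c` whenever `F(c, ν) = 0`.
[folklore] -/
theorem galerkinRHS_zero_eq_of_mem_variety {S : Finset (Fin 3 → ℤ)} {g : ↥S → EuclideanSpace ℂ (Fin 3)}
    {z : (↥S → EuclideanSpace ℂ (Fin 3)) × ℝ} (hz : z ∈ variety S g) :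
    galerkinRHS S 0 g z.1 = z.2 • stokesA S z.1 := by
  have h := hz.2
  rw [galerkinRHS_eq_neg_smul_stokesA_add] at h
  exact (neg_add_eq_zero.1 h).symm

/-- **Euler shadow.** Properness of the truncated Euler map at `g` (margin `δ` beyond radius `M`) gives the
Stokes rate on `V_N(g)`: `ν²‖c‖² ≥ (δ/(C_S+1))²`, `C_S = 4π² ∑_{m∈S} |m|²`, at every zero with `‖c‖ ≥ M`.
[folklore] -/
theorem stub_stokesRateOfEulerProper (N : ℕ) (g : ↥(PB N) → EuclideanSpace ℂ (Fin 3))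
    (hg : g ∈ galerkinSubspace (PB N))
    (hprop : ∃ M δ : ℝ, 0 < δ ∧ ∀ c ∈ galerkinSubspace (PB N), M ≤ ‖c‖ → δ ≤ ‖galerkinRHS (PB N) 0 g c‖) :
    StokesRate (PB N) g := by
  have _ := hg
  obtain ⟨M, δ, hδ, hM⟩ := hprop
  set C : ℝ := 4 * Real.pi ^ 2 * ∑ m ∈ PB N, freqNormSq m with hC
  have hC0 : 0 ≤ C := by
    have := Finset.sum_nonneg fun m (_ : m ∈ PB N) => freqNormSq_nonneg m
    rw [hC]; positivity
  refine ⟨M, (δ / (C + 1)) ^ 2, by positivity, fun z hz hzM => ?_⟩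
  -- `δ ≤ ‖F(c, 0)‖ = ‖ν A c‖ ≤ |ν| C ‖c‖`
  have hδle : δ ≤ |z.2| * (C * ‖z.1‖) := by
    refine (hM z.1 hz.1 hzM).trans ?_
    rw [galerkinRHS_zero_eq_of_mem_variety hz, norm_smul, Real.norm_eq_abs]
    exact mul_le_mul_of_nonneg_left (norm_stokesA_le z.1) (abs_nonneg _)
  have h2 : δ / (C + 1) ≤ |z.2| * ‖z.1‖ := by
    rw [div_le_iff₀ (by positivity)]
    calc δ ≤ |z.2| * (C * ‖z.1‖) := hδle
      _ ≤ |z.2| * ‖z.1‖ * (C + 1) := by nlinarith [abs_nonneg z.2, norm_nonneg z.1]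
  calc (δ / (C + 1)) ^ 2 ≤ (|z.2| * ‖z.1‖) ^ 2 := by gcongr
    _ = z.2 ^ 2 * ‖z.1‖ ^ 2 := by rw [mul_pow, sq_abs]

end Summit.AnomalousDissipation.AnomalousDissipation.Theorems.GenericRunawayStokesScaling.Line

end
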